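import Mathlib
import Summits.ValiantsHypothesis.ValiantsHypothesis.Theorems.SymPencilSymmetrizePermPairsPermifySubgroupHolds
import HarnessLib

/-!
# ValiantsHypothesis / SymPencil — crux `SymmetrizePermPairs` (stmt-ValiantsHypothesis-17793),
# stub `stub_induce`, ASSEMBLY [A4]: the `permify_subgroup` branch in the stub's binder vocabulary
# (`Γ' ≤ permPairSubst n`, budget `2^{(log₂ (m·R + m) + d)^d}`)

`permify_of_le_permPairSubst` (UNCONDITIONAL) — the bookkeeping of
`…RegularPermifyIndex.lean` ([R4]: pair homomorphism `θ`, `H = θ⁻¹(Γ')`, `Subgroup.index_comap`,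
`IsEquivariantDetRepr.anti`, `linSubst_permMatrix`) run over `permify_subgroup_holds` ([A5])
instead of the large-index-only `permify_regular_of_subgroup_qp`, with the budget conversion
`log₂ m + log₂ R ≤ 2 log₂ (m R + m)` (`two_mul_add_pow_le`).

Honest framing: assembly for an OPEN stub of an OPEN crux; the induced-block step (I1) and the
symmetric-output core (C3) are untouched, so this is NOT `stub_induce`; `VP ≠ VNP` is NOT proved and nothing here is progress on
it.  No new definitions, no named facts (`--supports stmt-ValiantsHypothesis-17793 --as helper`).
-/

noncomputable section

-- `Summit.ValiantsHypothesis.ValiantsHypothesis.…` is the tree's mandated single-conjunct layout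
-- (Sub = Summit), so the duplicated namespace component is intended.
set_option linter.dupNamespace false

namespace Summit.ValiantsHypothesis.ValiantsHypothesis.Theorems.SymPencilEquivariantSdcNotQP

open Literature.Computability.AlgebraicComplexity MvPolynomial Matrix

/-- **The `permify_subgroup` branch of `stub_induce` in the stub's own currency, unconditionally**:
there is `d` such that for every `Γ' ≤ Γ_n = permPairSubst n` (spelled VERBATIM) of relative index `R` and every
`Γ'`-equivariant affine determinantal representation `A` of `per_n` of size `m` there is an affine
pencil `A'` of size `m' ≤ 2^{(log₂ (m R + m) + d)^d}` — the budget of `stub_induce` — with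
`det A' = per_n`, on which (1) every pair substitution underlying an element of `Γ'` and (2) every
`γ ∈ Γ'` (tree action `Matrix.linSubstEntries`) acts by conjugation with a PERMUTATION matrix.
Proof: `permify_subgroup_holds` for `H = θ⁻¹(Γ')` (pair homomorphism `θ (π, ρ) = P_{(π × ρ)⁻¹}`,
range `Γ_n`, `[𝔖_n² : H] = R` by `Subgroup.index_comap`) and `log₂ m + log₂ R ≤ 2 log₂ (m R + m)`.
What it is NOT: `stub_induce` — the output is `Γ'`-permified, neither `Γ_n`-equivariant nor symmetric
(cores (I1)/(C3)). [folklore] -/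
theorem permify_of_le_permPairSubst :
    ∃ d : ℕ, ∀ (n m : ℕ) (Γ' : Subgroup (GL (Fin n × Fin n) ℂ)),
    Γ' ≤ Subgroup.closure {γ : GL (Fin n × Fin n) ℂ | ∃ π ρ : Equiv.Perm (Fin n),
      (γ : Matrix (Fin n × Fin n) (Fin n × Fin n) ℂ) = Equiv.Perm.permMatrix ℂ (Equiv.prodCongr π ρ)} →
    ∀ (A : Matrix (Fin m) (Fin m) (MvPolynomial (Fin n × Fin n) ℂ)),
    IsEquivariantDetRepr Γ' (perPoly (Fin n) ℂ) A →
    ∃ m' ≤ 2 ^ ((Nat.log 2 (m * Γ'.relIndex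
        (Subgroup.closure {γ : GL (Fin n × Fin n) ℂ | ∃ π ρ : Equiv.Perm (Fin n),
          (γ : Matrix (Fin n × Fin n) (Fin n × Fin n) ℂ) =
            Equiv.Perm.permMatrix ℂ (Equiv.prodCongr π ρ)}) + m) + d) ^ d),
      ∃ A' : Matrix (Fin m') (Fin m') (MvPolynomial (Fin n × Fin n) ℂ),
        IsAffineDetRepr (perPoly (Fin n) ℂ) A' ∧
        (∀ π ρ : Equiv.Perm (Fin n),
          (∃ γ ∈ Γ', (γ : Matrix (Fin n × Fin n) (Fin n × Fin n) ℂ) =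
            Equiv.Perm.permMatrix ℂ (Equiv.prodCongr π ρ)) →
          ∃ σ : Equiv.Perm (Fin m'),
            A'.map (MvPolynomial.rename fun ij : Fin n × Fin n => (π ij.1, ρ ij.2)) =
              (σ.permMatrix ℂ).map MvPolynomial.C * A' * ((σ.permMatrix ℂ)ᵀ).map MvPolynomial.C) ∧
        (∀ γ ∈ Γ', ∃ σ : Equiv.Perm (Fin m'),
          Matrix.linSubstEntries γ A' =
            (σ.permMatrix ℂ).map MvPolynomial.C * A' * ((σ.permMatrix ℂ)ᵀ).map MvPolynomial.C) := by
  classical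
  obtain ⟨d₀, hd₀⟩ := permify_subgroup_holds
  refine ⟨2 * d₀ + 2, fun n m Γ' hle A hA => ?_⟩
  -- `n = deg per_n ≤ m`
  have hnm : n ≤ m := by
    have h := totalDegree_le_of_hasDetRepr_holds
      (show HasDetRepr (perPoly (Fin n) ℂ) m from ⟨A, hA.1⟩)
    rwa [totalDegree_perPoly_holds, Fintype.card_fin] at h
  -- the pair homomorphism `θ (π, ρ) = P_{(π × ρ)⁻¹}` into `GL(n², ℂ)`
  let θ₀ : Equiv.Perm (Fin n) × Equiv.Perm (Fin n) →* Equiv.Perm (Fin n × Fin n) :=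
    { toFun := fun πρ => Equiv.prodCongr πρ.1 πρ.2
      map_one' := by ext ⟨i, j⟩ <;> rfl
      map_mul' := fun a b => by ext ⟨i, j⟩ <;> rfl }
  let θ : Equiv.Perm (Fin n) × Equiv.Perm (Fin n) →* GL (Fin n × Fin n) ℂ :=
    (Matrix.permMatrixHom (n := Fin n × Fin n) (R := ℂ)).toHomUnits.comp θ₀
  have hθinv : ∀ πρ : Equiv.Perm (Fin n) × Equiv.Perm (Fin n),
      (((θ πρ)⁻¹ : GL (Fin n × Fin n) ℂ) : Matrix (Fin n × Fin n) (Fin n × Fin n) ℂ) =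
        Equiv.Perm.permMatrix ℂ (Equiv.prodCongr πρ.1 πρ.2) := fun πρ => rfl
  have hθ : ∀ πρ : Equiv.Perm (Fin n) × Equiv.Perm (Fin n),
      ((θ πρ : GL (Fin n × Fin n) ℂ) : Matrix (Fin n × Fin n) (Fin n × Fin n) ℂ) =
        Equiv.Perm.permMatrix ℂ (Equiv.prodCongr πρ.1 πρ.2)⁻¹ := fun πρ => rfl
  -- from a matrix identity to an identity in `GL`
  have hunit : ∀ (πρ : Equiv.Perm (Fin n) × Equiv.Perm (Fin n)) (γ : GL (Fin n × Fin n) ℂ),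
      (γ : Matrix (Fin n × Fin n) (Fin n × Fin n) ℂ) =
        Equiv.Perm.permMatrix ℂ (Equiv.prodCongr πρ.1 πρ.2) → θ πρ = γ⁻¹ := by
    intro πρ γ hγ
    rw [← _root_.inv_inj, inv_inv]
    exact Units.ext (by rw [hθinv]; exact hγ.symm)
  -- `Γ_n` is the range of `θ`
  have hrange : Subgroup.closure {γ : GL (Fin n × Fin n) ℂ | ∃ π ρ : Equiv.Perm (Fin n),
      (γ : Matrix (Fin n × Fin n) (Fin n × Fin n) ℂ) =
        Equiv.Perm.permMatrix ℂ (Equiv.prodCongr π ρ)} = θ.range := by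
    apply le_antisymm
    · rw [Subgroup.closure_le]
      rintro γ ⟨π, ρ, hγ⟩
      refine ⟨(π, ρ)⁻¹, ?_⟩
      rw [map_inv, hunit (π, ρ) γ hγ, inv_inv]
    · rintro γ ⟨πρ, rfl⟩
      refine Subgroup.subset_closure ⟨πρ.1⁻¹, πρ.2⁻¹, ?_⟩
      have he : (Equiv.prodCongr πρ.1 πρ.2)⁻¹ = Equiv.prodCongr πρ.1⁻¹ πρ.2⁻¹ :=
        Equiv.ext fun _ => rfl
      rw [hθ, he]
  -- the subgroup of pairs and its index
  set H : Subgroup (Equiv.Perm (Fin n) × Equiv.Perm (Fin n)) := Γ'.comap θ with hH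
  have hmemH : ∀ πρ, πρ ∈ H ↔ θ πρ ∈ Γ' := fun πρ => by rw [hH, Subgroup.mem_comap]
  have hHindex : H.index = Γ'.relIndex (Subgroup.closure {γ : GL (Fin n × Fin n) ℂ |
      ∃ π ρ : Equiv.Perm (Fin n), (γ : Matrix (Fin n × Fin n) (Fin n × Fin n) ℂ) =
        Equiv.Perm.permMatrix ℂ (Equiv.prodCongr π ρ)}) := by
    rw [hH, Subgroup.index_comap, ← hrange]
  -- `Γ'`-equivariance restricts to the closure of the pair matrices of `H`
  have hleH : Subgroup.closure {γ : GL (Fin n × Fin n) ℂ |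
      ∃ πρ ∈ H, (γ : Matrix (Fin n × Fin n) (Fin n × Fin n) ℂ) =
        Equiv.Perm.permMatrix ℂ (Equiv.prodCongr πρ.1 πρ.2)} ≤ Γ' := by
    rw [Subgroup.closure_le]
    rintro γ ⟨πρ, hπρ, hγ⟩
    have h1 : γ = (θ πρ)⁻¹ := by rw [hunit πρ γ hγ, inv_inv]
    rw [SetLike.mem_coe, h1]
    exact Γ'.inv_mem ((hmemH πρ).mp hπρ)
  have hAH := hA.anti hleH
  obtain ⟨m', hm', A', hA', hperm⟩ := hd₀ n m H A hAH
  refine ⟨m', hm'.trans ?_, A', hA', fun π ρ hπρ => ?_, fun γ hγ => ?_⟩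
  · -- budget: `log₂ m + log₂ R ≤ 2 log₂ (m R + m)` (for `m = 0`: `n = 0` and `R = 1`)
    rw [← hHindex]
    have hlog : Nat.log 2 m + Nat.log 2 H.index ≤ 2 * Nat.log 2 (m * H.index + m) := by
      rcases Nat.eq_zero_or_pos m with hm0 | hm
      · -- `m = 0`: then `n = 0` and every index in `𝔖_0 × 𝔖_0` is `1`
        have hn0 : n = 0 := by omega
        subst hn0
        have hcard : Nat.card (Equiv.Perm (Fin 0) × Equiv.Perm (Fin 0)) = 1 := by
          rw [Nat.card_prod, Nat.card_perm, Nat.card_eq_fintype_card, Fintype.card_fin]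
          rfl
        have hRle : H.index ≤ 1 := by
          have h := H.index_mul_card
          rw [hcard] at h
          exact Nat.le_of_dvd Nat.one_pos ⟨Nat.card H, h.symm⟩
        have hR0 : Nat.log 2 H.index = 0 := Nat.log_eq_zero_iff.mpr (Or.inl (by omega))
        rw [hm0, hR0]
        simp
      · have h1 : Nat.log 2 m ≤ Nat.log 2 (m * H.index + m) := Nat.log_mono_right (Nat.le_add_left _ _)
        have h2 : Nat.log 2 H.index ≤ Nat.log 2 (m * H.index + m) := by
          refine Nat.log_mono_right ?_
          calc H.index = 1 * H.index := (one_mul _).symm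
            _ ≤ m * H.index := Nat.mul_le_mul_right _ hm
            _ ≤ m * H.index + m := Nat.le_add_right _ _
        omega
    calc 2 ^ ((Nat.log 2 m + Nat.log 2 H.index + d₀) ^ d₀)
        ≤ 2 ^ ((2 * Nat.log 2 (m * H.index + m) + d₀) ^ d₀) :=
          Nat.pow_le_pow_right (by norm_num) (Nat.pow_le_pow_left (by omega) d₀)
      _ ≤ 2 ^ ((Nat.log 2 (m * H.index + m) + (2 * d₀ + 2)) ^ (2 * d₀ + 2)) :=
          Nat.pow_le_pow_right (by norm_num) (two_mul_add_pow_le _ _)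
  · -- (1): the pair lies in `H`
    obtain ⟨γ, hγ, hγe⟩ := hπρ
    refine hperm (π, ρ) ((hmemH _).mpr ?_)
    rw [hunit (π, ρ) γ hγe]
    exact Γ'.inv_mem hγ
  · -- (2): `γ = θ (π, ρ)` for a pair of `H`, acting by `rename (π × ρ)`
    obtain ⟨πρ, hπρ⟩ : γ ∈ θ.range := by rw [← hrange]; exact hle hγ
    have hmem : πρ ∈ H := (hmemH πρ).mpr (by rw [hπρ]; exact hγ)
    obtain ⟨σ, hσ⟩ := hperm πρ hmem
    refine ⟨σ, ?_⟩
    rw [← hσ, ← hπρ]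
    change A'.map (linSubst (Fin n × Fin n) ℂ
      ((θ πρ : GL (Fin n × Fin n) ℂ) : Matrix (Fin n × Fin n) (Fin n × Fin n) ℂ)) = _
    rw [hθ, linSubst_permMatrix]
    have hfun : (⇑((Equiv.prodCongr πρ.1 πρ.2)⁻¹).symm : Fin n × Fin n → Fin n × Fin n) =
        fun ij => (πρ.1 ij.1, πρ.2 ij.2) := by
      funext ij
      rfl
    rw [hfun]

end Summit.ValiantsHypothesis.ValiantsHypothesis.Theorems.SymPencilEquivariantSdcNotQP

end
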